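/-
Copyright (c) 2026 the pub-hodgecm-mathlib formalisation cell (harness21).  Prover seat hodgecm-mathlib-K2E3-p25 (g2), HCML Track B «K2-LIT»,
h413 = `stmt-HodgeConjecture-24833`, road (11-3-split-nsc), leaf (nsc-S-A′), brick (E4b-1γ, part 3a = DESCENT of the cell map to the Jacquet module) of the weak cell
lemma (dealer D105′).  2026-09-04.
-/
import Summits.HodgeConjecture.HodgeConjecture.Theorems.K2E3GL3BorelInducedJacquetQOpenCellIntegrand   -- ★ parts 1, 2a, 2b
import Summits.HodgeConjecture.HodgeConjecture.Theorems.K2E3GL3BorelInducedJacquetQFiltration       -- ★ (E4b-1α) `smoothIndRep_mem_vanishingOn_of_mul_mem`, `minor_mul_eq_zero_of_mem_parabolic_twoOne`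
import Literature.NumberTheory.Automorphic.IntertwiningMapCharacterCoinvariants                     -- ★ `avgProj_eq_zero_of_mem_coinvariantsKer`
import Literature.NumberTheory.Automorphic.UnipotentRadicalCompactOpenProofs                        -- ★ `isLimitOfCompactOpen_unipotentRadicalGL`, `isClosed_unipotentRadicalGL`
import HarnessLib

/-!
# K2_E3 road (h413), leaf (nsc-S-A′), brick E4b-1γ part 3a — a `U_P`-invariant linear map on the functions vanishing on `Z` descends to their classes in the Jacquet module

Cell `pub/hodgecm-mathlib` (D-0151), Track B, seat K2E3-p25 (g2).  `--supports stmt-HodgeConjecture-24833 --as helper`; THEOREMS ONLY (no `def`, no instance, no notation,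
no `sorry`); never imports `Cruxes/…/Lines`.  COUNT-NEUTRAL.

THE MATHEMATICS ([BernsteinZelevinsky1976, §2.3, 2.33 (Jacquet's lemma)]; [BernsteinZelevinsky1977, Prop. 1.9 (a), §5]; [Casselman1995, §2.1, §3.3]).  `I = Ind_B^{GL₃} σ′`,
`X_Z ≤ I` the functions vanishing on `Z = {m = 0}` (right `P`-stable), `U = U_P`.
* §1 LOCALISATION: a vector in the coinvariant kernel `I(U)` already lies in `I(S)` for some COMPACT subgroup `S ≤ U` (finitely many group elements occur in a presentation;
  `U` is the union of its compact open subgroups, ★ `isLimitOfCompactOpen_unipotentRadicalGL`): `exists_isCompact_mem_coinvariantsKer`.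
* §2 `X_Z` is stable under `U` and under the averaging projectors `e_S` (`S ≤ U` compact): `smoothIndRep_mem_vanishingOn_Z`, `avgProj_mem_vanishingOn_Z`.
* §3 **DESCENT** `exists_descend`: a linear map `Ψ̃ : X_Z → Y` with `Ψ̃(u·f) = Ψ̃(f)` for all `u ∈ U` satisfies `Ψ̃ f = Ψ̃ f′` whenever `[f] = [f′]` in `r_U(I)`
  (`d = f − f′ ∈ X_Z ∩ I(U)` lies in `I(S)`, so `e_S d = 0` by ★ `avgProj_eq_zero_of_mem_coinvariantsKer`, while `Ψ̃(e_S d) = Ψ̃(d)` as `e_S d` is an average of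
  `U`-translates), hence induces a linear map `Ψ` on any subrepresentation `J_Z` of `r_U(I)` whose elements are the classes of `X_Z`, with `Ψ [f] = Ψ̃ f`.
Part 3b: the cell map of ★ part 2c is `U_P`-invariant and `GL₂`-equivariant (value formula + ★ part 2b) and has trivial kernel on `J_Z` — K2E3-p03's letter L2.

HONEST LABEL: HC_CM is proved only modulo the 7 printed citations (2 remaining named inputs: hLiu418 = stmt-HodgeConjecture-24832, h413 = stmt-HodgeConjecture-24833) until rung 0
closes; count-neutral helper.

## References
* [BernsteinZelevinsky1976] I. N. Bernstein, A. V. Zelevinsky, *Representations of the group GL(n,F)…*, Russian Math. Surveys 31 (1976), §2.3, 2.33.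
* [BernsteinZelevinsky1977] I. N. Bernstein, A. V. Zelevinsky, *Induced representations of reductive p-adic groups I*, Ann. Sci. ÉNS 10 (1977), Prop. 1.9 (a), §5.
* [Casselman1995] W. Casselman, *Introduction to the theory of admissible representations of p-adic reductive groups* (draft 1995), §2.1, §3.3.
-/

set_option autoImplicit false
set_option linter.dupNamespace false

noncomputable section

open Function Representation
open scoped MatrixGroups
open Literature.NumberTheory.Automorphic
open Summit.HodgeConjecture.HodgeConjecture.Cruxes.H413.K2E3GL3BorelInducedJacquetQFiltration

namespace Summit.HodgeConjecture.HodgeConjecture.Cruxes.H413.K2E3GL3BorelInducedJacquetQOpenCellDescent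

variable {F : Type} [Field F] [ValuativeRel F] [TopologicalSpace F] [IsNonarchimedeanLocalField F]

/-! ## §1 Localisation of the coinvariant kernel on a compact subgroup of `U_c` -/

section Localisation

variable {n : ℕ} {α : Type*} [LinearOrder α] {c : Fin n → α} {V : Type*} [AddCommGroup V] [Module ℂ V] (π : Representation ℂ (GL (Fin n) F) V)

omit [ValuativeRel F] [TopologicalSpace F] [IsNonarchimedeanLocalField F] in
/-- Monotonicity of the coinvariant kernel in the subgroup. [folklore] -/
theorem coinvariantsKer_comp_subtype_mono {S S' : Subgroup (GL (Fin n) F)} (h : S ≤ S') :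
    Coinvariants.ker (π.comp S.subtype) ≤ Coinvariants.ker (π.comp S'.subtype) := by
  refine Submodule.span_le.2 ?_
  rintro _ ⟨⟨s, v⟩, rfl⟩
  exact Coinvariants.mem_ker_of_eq (ρ := π.comp S'.subtype) ⟨(s : GL (Fin n) F), h s.2⟩ v _ rfl

/-- **LOCALISATION**: a vector of the `U_c`-coinvariant kernel of `π` lies in the `S`-coinvariant kernel for some COMPACT subgroup `S ≤ U_c` (`c` monotone).
[cite: BernsteinZelevinsky1976, 2.33] [cite: BernsteinZelevinsky1977, Prop. 1.9 (a)] -/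
theorem exists_isCompact_mem_coinvariantsKer (hc : Monotone c) {x : V} (hx : x ∈ Coinvariants.ker (restrictUnipotentGL F c π)) :
    ∃ S : Subgroup (GL (Fin n) F), S ≤ unipotentRadicalGL F c ∧ IsCompact (S : Set (GL (Fin n) F)) ∧ x ∈ Coinvariants.ker (π.comp S.subtype) := by
  haveI : IsTopologicalRing F := inferInstance
  haveI : T2Space F := (Literature.NumberTheory.GaloisRepresentations.IsNonarchimedeanLocalField.isLocalField F).toT2Space
  have hN := isLimitOfCompactOpen_unipotentRadicalGL F c hc
  -- a compact subgroup of `U_c` containing a given compact subset of `U_c` (as a subset of `GL_n`)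
  have hgrow : ∀ C : Set (GL (Fin n) F), IsCompact C → C ⊆ unipotentRadicalGL F c →
      ∃ S : Subgroup (GL (Fin n) F), S ≤ unipotentRadicalGL F c ∧ IsCompact (S : Set (GL (Fin n) F)) ∧ C ⊆ S := by
    intro C hC hCU
    have hC' : IsCompact ((Subtype.val : ↥(unipotentRadicalGL F c) → GL (Fin n) F) ⁻¹' C) :=
      (isClosed_unipotentRadicalGL (R := F) (c := c)).isClosedEmbedding_subtypeVal.isCompact_preimage hC
    obtain ⟨K, -, hKc, hCK⟩ := hN _ hC'
    refine ⟨K.map (unipotentRadicalGL F c).subtype, fun g hg => ?_, ?_, fun g hg => ?_⟩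
    · obtain ⟨k, -, rfl⟩ := hg; exact k.2
    · rw [Subgroup.coe_map]; exact hKc.image continuous_subtype_val
    · exact ⟨⟨g, hCU hg⟩, hCK (by exact hg), rfl⟩
  refine Submodule.span_induction (p := fun x _ => ∃ S : Subgroup (GL (Fin n) F), S ≤ unipotentRadicalGL F c ∧ IsCompact (S : Set (GL (Fin n) F)) ∧
      x ∈ Coinvariants.ker (π.comp S.subtype)) ?_ ?_ ?_ ?_ hx
  · rintro _ ⟨⟨u, v⟩, rfl⟩
    have hu : (((u : ↥(standardParabolicGL F c)) : GL (Fin n) F)) ∈ unipotentRadicalGL F c := ⟨u, u.2, rfl⟩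
    obtain ⟨S, hSU, hSc, hS⟩ := hgrow {((u : ↥(standardParabolicGL F c)) : GL (Fin n) F)} isCompact_singleton (Set.singleton_subset_iff.2 hu)
    exact ⟨S, hSU, hSc, Coinvariants.mem_ker_of_eq (ρ := π.comp S.subtype) ⟨_, hS (Set.mem_singleton _)⟩ v _ rfl⟩
  · exact ⟨⊥, bot_le, by rw [Subgroup.coe_bot]; exact isCompact_singleton, Submodule.zero_mem _⟩
  · rintro x y - - ⟨S₁, h₁U, h₁c, h₁⟩ ⟨S₂, h₂U, h₂c, h₂⟩
    obtain ⟨S, hSU, hSc, hS⟩ := hgrow ((S₁ : Set (GL (Fin n) F)) ∪ S₂) (h₁c.union h₂c) (Set.union_subset h₁U h₂U)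
    exact ⟨S, hSU, hSc, Submodule.add_mem _ (coinvariantsKer_comp_subtype_mono π (fun g hg => hS (Or.inl hg)) h₁)
      (coinvariantsKer_comp_subtype_mono π (fun g hg => hS (Or.inr hg)) h₂)⟩
  · rintro a x - ⟨S, hSU, hSc, hS⟩
    exact ⟨S, hSU, hSc, Submodule.smul_mem _ a hS⟩

end Localisation

/-! ## §2 `X_Z` is stable under `U_P` and under the averaging projectors -/

section Stability

variable (σ' : Representation ℂ ↥(standardParabolicGL F (id : Fin 3 → Fin 3)) ℂ)

/-- **`X_Z` is stable under right translation by `P_{(2,1)}`** (★ E4b-1α). [cite: BernsteinZelevinsky1977, §5] -/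
theorem smoothIndRep_mem_vanishingOn_Z {p : GL (Fin 3) F} (hp : p ∈ standardParabolicGL F (![0, 0, 1] : Fin 3 → Fin 2))
    {f : SmoothInd (standardParabolicGL F (id : Fin 3 → Fin 3)) σ'}
    (hf : f ∈ vanishingOn (standardParabolicGL F (id : Fin 3 → Fin 3)) σ'
      {g : GL (Fin 3) F | (g : Matrix (Fin 3) (Fin 3) F) 1 0 * (g : Matrix (Fin 3) (Fin 3) F) 2 1 - (g : Matrix (Fin 3) (Fin 3) F) 1 1 * (g : Matrix (Fin 3) (Fin 3) F) 2 0 = 0}) :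
    smoothIndRep (standardParabolicGL F (id : Fin 3 → Fin 3)) σ' p f ∈ vanishingOn (standardParabolicGL F (id : Fin 3 → Fin 3)) σ'
      {g : GL (Fin 3) F | (g : Matrix (Fin 3) (Fin 3) F) 1 0 * (g : Matrix (Fin 3) (Fin 3) F) 2 1 - (g : Matrix (Fin 3) (Fin 3) F) 1 1 * (g : Matrix (Fin 3) (Fin 3) F) 2 0 = 0} :=
  smoothIndRep_mem_vanishingOn_of_mul_mem (![0, 0, 1] : Fin 3 → Fin 2) σ' _ (fun z hz q hq => minor_mul_eq_zero_of_mem_parabolic_twoOne z hz q hq) hp hf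

/-- **`X_Z` is stable under `e_S` for a compact subgroup `S ≤ U_P`** (`e_S f` is a finite average of `U_P`-translates of `f`). [cite: Casselman1995, §2.1] -/
theorem avgProj_mem_vanishingOn_Z {S : Subgroup (GL (Fin 3) F)} (hSU : S ≤ unipotentRadicalGL F (![0, 0, 1] : Fin 3 → Fin 2)) (hS : IsCompact (S : Set (GL (Fin 3) F)))
    {f : SmoothInd (standardParabolicGL F (id : Fin 3 → Fin 3)) σ'}
    (hf : f ∈ vanishingOn (standardParabolicGL F (id : Fin 3 → Fin 3)) σ'
      {g : GL (Fin 3) F | (g : Matrix (Fin 3) (Fin 3) F) 1 0 * (g : Matrix (Fin 3) (Fin 3) F) 2 1 - (g : Matrix (Fin 3) (Fin 3) F) 1 1 * (g : Matrix (Fin 3) (Fin 3) F) 2 0 = 0}) :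
    (smoothIndRep (standardParabolicGL F (id : Fin 3 → Fin 3)) σ').avgProj S f ∈ vanishingOn (standardParabolicGL F (id : Fin 3 → Fin 3)) σ'
      {g : GL (Fin 3) F | (g : Matrix (Fin 3) (Fin 3) F) 1 0 * (g : Matrix (Fin 3) (Fin 3) F) 2 1 - (g : Matrix (Fin 3) (Fin 3) F) 1 1 * (g : Matrix (Fin 3) (Fin 3) F) 2 0 = 0} := by
  classical
  have hv : (smoothIndRep (standardParabolicGL F (id : Fin 3 → Fin 3)) σ').IsSmoothVector f := isSmooth_smoothInd _ _ f
  obtain ⟨R, hR⟩ := exists_isLeftTransversal hS hv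
  rw [avgProj_eq hS hv (fun t ht => ((smoothIndRep _ σ').mem_stabilizerSubgroup f t).1 ht) hR]
  refine Submodule.smul_mem _ _ (Submodule.sum_mem _ fun r hr => ?_)
  exact smoothIndRep_mem_vanishingOn_Z σ' (unipotentRadicalGL_le F _ (hSU (hR.mem_of_mem r hr))) hf

end Stability

/-! ## §3 Descent of a `U_P`-invariant linear map on `X_Z` -/

section Descent

variable (σ' : Representation ℂ ↥(standardParabolicGL F (id : Fin 3 → Fin 3)) ℂ) {Y : Type*} [AddCommGroup Y] [Module ℂ Y]

/-- **DESCENT.**  A linear map `Ψ̃` on `X_Z` with `Ψ̃(u·f) = Ψ̃(f)` for `u ∈ U_P` takes the same value on functions with the same class in `r_P(I)`.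
[cite: BernsteinZelevinsky1976, 2.33] [cite: Casselman1995, §2.1, §3.3] -/
theorem eq_of_mk_eq
    (Φ : ↥(vanishingOn (standardParabolicGL F (id : Fin 3 → Fin 3)) σ'
      {g : GL (Fin 3) F | (g : Matrix (Fin 3) (Fin 3) F) 1 0 * (g : Matrix (Fin 3) (Fin 3) F) 2 1 - (g : Matrix (Fin 3) (Fin 3) F) 1 1 * (g : Matrix (Fin 3) (Fin 3) F) 2 0 = 0}) →ₗ[ℂ] Y)
    (hΦ : ∀ (u : GL (Fin 3) F) (hu : u ∈ unipotentRadicalGL F (![0, 0, 1] : Fin 3 → Fin 2))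
      (f : ↥(vanishingOn (standardParabolicGL F (id : Fin 3 → Fin 3)) σ'
        {g : GL (Fin 3) F | (g : Matrix (Fin 3) (Fin 3) F) 1 0 * (g : Matrix (Fin 3) (Fin 3) F) 2 1 - (g : Matrix (Fin 3) (Fin 3) F) 1 1 * (g : Matrix (Fin 3) (Fin 3) F) 2 0 = 0})),
      Φ ⟨smoothIndRep (standardParabolicGL F (id : Fin 3 → Fin 3)) σ' u f, smoothIndRep_mem_vanishingOn_Z σ' (unipotentRadicalGL_le F _ hu) f.2⟩ = Φ f)
    (f f' : ↥(vanishingOn (standardParabolicGL F (id : Fin 3 → Fin 3)) σ'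
      {g : GL (Fin 3) F | (g : Matrix (Fin 3) (Fin 3) F) 1 0 * (g : Matrix (Fin 3) (Fin 3) F) 2 1 - (g : Matrix (Fin 3) (Fin 3) F) 1 1 * (g : Matrix (Fin 3) (Fin 3) F) 2 0 = 0}))
    (h : Coinvariants.mk (restrictUnipotentGL F (![0, 0, 1] : Fin 3 → Fin 2) (smoothIndRep (standardParabolicGL F (id : Fin 3 → Fin 3)) σ'))
        (f : SmoothInd (standardParabolicGL F (id : Fin 3 → Fin 3)) σ') =
      Coinvariants.mk (restrictUnipotentGL F (![0, 0, 1] : Fin 3 → Fin 2) (smoothIndRep (standardParabolicGL F (id : Fin 3 → Fin 3)) σ'))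
        (f' : SmoothInd (standardParabolicGL F (id : Fin 3 → Fin 3)) σ')) :
    Φ f = Φ f' := by
  classical
  haveI : IsTopologicalRing F := inferInstance
  -- `d = f − f′ ∈ I(U)`, localised on a compact `S ≤ U`
  rw [← sub_eq_zero, ← map_sub]
  set d := f - f' with hd
  have hdker : ((d : SmoothInd (standardParabolicGL F (id : Fin 3 → Fin 3)) σ')) ∈
      Coinvariants.ker (restrictUnipotentGL F (![0, 0, 1] : Fin 3 → Fin 2) (smoothIndRep (standardParabolicGL F (id : Fin 3 → Fin 3)) σ')) := by
    rw [hd, Submodule.coe_sub, ← Coinvariants.mk_eq_iff]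
    exact h
  obtain ⟨S, hSU, hSc, hdS⟩ := exists_isCompact_mem_coinvariantsKer (smoothIndRep (standardParabolicGL F (id : Fin 3 → Fin 3)) σ')
    K2E3GL3MaximalParabolicRelabel.monotone_twoOne hdker
  -- `e_S d = 0`
  have havg0 : (smoothIndRep (standardParabolicGL F (id : Fin 3 → Fin 3)) σ').avgProj S (d : SmoothInd (standardParabolicGL F (id : Fin 3 → Fin 3)) σ') = 0 :=
    avgProj_eq_zero_of_mem_coinvariantsKer _ hSc (isSmooth_smoothInd _ σ') hdS
  -- `Φ (e_S d) = Φ d`: `e_S d = #R⁻¹ Σ_r r·d`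
  have hv : (smoothIndRep (standardParabolicGL F (id : Fin 3 → Fin 3)) σ').IsSmoothVector (d : SmoothInd (standardParabolicGL F (id : Fin 3 → Fin 3)) σ') :=
    isSmooth_smoothInd _ _ _
  obtain ⟨R, hR⟩ := exists_isLeftTransversal hSc hv
  have havg := avgProj_eq hSc hv (fun t ht => ((smoothIndRep _ σ').mem_stabilizerSubgroup _ t).1 ht) hR
  have hmem : ∀ r ∈ R, r ∈ unipotentRadicalGL F (![0, 0, 1] : Fin 3 → Fin 2) := fun r hr => hSU (hR.mem_of_mem r hr)
  -- the average as an element of `X_Z`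
  have hsum : (⟨(smoothIndRep (standardParabolicGL F (id : Fin 3 → Fin 3)) σ').avgProj S (d : SmoothInd (standardParabolicGL F (id : Fin 3 → Fin 3)) σ'),
      avgProj_mem_vanishingOn_Z σ' hSU hSc d.2⟩ : ↥(vanishingOn (standardParabolicGL F (id : Fin 3 → Fin 3)) σ'
        {g : GL (Fin 3) F | (g : Matrix (Fin 3) (Fin 3) F) 1 0 * (g : Matrix (Fin 3) (Fin 3) F) 2 1 - (g : Matrix (Fin 3) (Fin 3) F) 1 1 * (g : Matrix (Fin 3) (Fin 3) F) 2 0 = 0})) =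
      (R.card : ℂ)⁻¹ • ∑ r ∈ R.attach, (⟨smoothIndRep (standardParabolicGL F (id : Fin 3 → Fin 3)) σ' (r : GL (Fin 3) F) d,
        smoothIndRep_mem_vanishingOn_Z σ' (unipotentRadicalGL_le F _ (hmem r r.2)) d.2⟩) := by
    apply Subtype.ext
    simp only [Submodule.coe_smul, AddSubmonoidClass.coe_finsetSum]
    rw [havg, Finset.sum_attach R (fun r => smoothIndRep (standardParabolicGL F (id : Fin 3 → Fin 3)) σ' r (d : SmoothInd _ σ'))]
  have hΦavg : Φ ⟨(smoothIndRep (standardParabolicGL F (id : Fin 3 → Fin 3)) σ').avgProj S (d : SmoothInd (standardParabolicGL F (id : Fin 3 → Fin 3)) σ'),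
      avgProj_mem_vanishingOn_Z σ' hSU hSc d.2⟩ = Φ d := by
    rw [hsum, map_smul, map_sum]
    have : ∑ r ∈ R.attach, Φ ⟨smoothIndRep (standardParabolicGL F (id : Fin 3 → Fin 3)) σ' (r : GL (Fin 3) F) d,
        smoothIndRep_mem_vanishingOn_Z σ' (unipotentRadicalGL_le F _ (hmem r r.2)) d.2⟩ = ∑ r ∈ R.attach, Φ d :=
      Finset.sum_congr rfl fun r _ => hΦ _ (hmem r r.2) d
    rw [this, Finset.sum_const, Finset.card_attach, ← Nat.cast_smul_eq_nsmul ℂ, smul_smul,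
      inv_mul_cancel₀ (Nat.cast_ne_zero.2 (Finset.card_ne_zero.2 hR.nonempty)), one_smul]
  rw [← hΦavg]
  have h0 : (⟨(smoothIndRep (standardParabolicGL F (id : Fin 3 → Fin 3)) σ').avgProj S (d : SmoothInd (standardParabolicGL F (id : Fin 3 → Fin 3)) σ'),
      avgProj_mem_vanishingOn_Z σ' hSU hSc d.2⟩ : ↥(vanishingOn (standardParabolicGL F (id : Fin 3 → Fin 3)) σ'
        {g : GL (Fin 3) F | (g : Matrix (Fin 3) (Fin 3) F) 1 0 * (g : Matrix (Fin 3) (Fin 3) F) 2 1 - (g : Matrix (Fin 3) (Fin 3) F) 1 1 * (g : Matrix (Fin 3) (Fin 3) F) 2 0 = 0})) = 0 :=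
    Subtype.ext havg0
  rw [h0, map_zero]

end Descent

end Summit.HodgeConjecture.HodgeConjecture.Cruxes.H413.K2E3GL3BorelInducedJacquetQOpenCellDescent

end
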